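import Mathlib
import Summits.CriticalPhenomena.PercolationContinuityZ3.Theorems.PercNearOneGluingNearOneGluingLrfDepthOneSeq
import HarnessLib

/-!
# Crux `PercNearOneGluing.NearOneGluing` (stmt-CriticalPhenomena-4574), line `SketchR2I5` — stub `stub_lrfDepthOneStatic`

Helper file for the crux (lead prover-line-stmt-CriticalPhenomena-4574-c3, cycle 3): the
**least-reliable-first gluing inequality at depth one, static order, any number of relays**
(the depth-one case of the registered LRF conjecture `stub_lrfGluing`).  Proves exactly the
registered stub signature; lands with `--supports stmt-CriticalPhenomena-4574`.

## Content

Weighted complete graph on `Fin n`, `μ = prodBernoulli w`.  Every positive-weight neighbour of `o`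
is one of the relays `a 0, …, a (k-1)` (injective, `≠ o`), and the relays are sorted by
unreliability in `w` itself: `μ(a j ↔ b) ≤ μ(a i ↔ b)` for `j < i`.  Then, with
`p_i = w s(o, a i)` and `u_i = μ(a i ↮ b)`,
`μ(o ↮ b, ∃ i, o ↔ a i) ≤ F(id) := Σ_i p_i ∏_{l<i} (1 − p_l) · u_i`.

## Proof

* **Rearrangement** (`LrfDepthOneStatic.sum_perm_le`): for `p_i ∈ [0, 1]` and `u` non-increasing,
  `F(σ) ≤ F(id)` for every permutation `σ`, where `F(σ) = Σ_i p_{σ i} ∏_{l<i} (1 − p_{σ l}) u_{σ i}`.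
  We write `F` as a right fold over the list of indices (`x :: L ↦ p_x u_x + (1 − p_x) F(L)`),
  prove the adjacent exchange inequality `F(x :: y :: L) ≤ F(y :: x :: L)` for `u_x ≤ u_y`
  (the difference is `p_x p_y (u_y − u_x)`), deduce that insertion sort by index does not
  decrease `F`, and identify the sorted list with `List.finRange k`.
* **A sequential order exists** (`LrfDepthOneStatic.exists_seqOrder`): greedily, `σ 0` minimises
  `μ_w(a i ↔ b)`, then recurse with the pair `s(o, a (σ 0))` zeroed
  (`Equiv.Perm.decomposeFin`); the bookkeeping of the zeroed weights is
  `LrfDepthOneStatic.seqAdm_cons`.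
* Apply the landed sequential theorem `stub_lrfDepthOneSeq` to the family `a ∘ σ` (its other
  hypotheses are permutation invariant, and so is the bad event) to get `bad ≤ F(σ) ≤ F(id)`.
-/

namespace Summit.CriticalPhenomena.PercolationContinuityZ3.Theorems

open MeasureTheory Set Literature.Probability.LatticeModels Literature.Probability.Percolation
open scoped Classical BigOperators

namespace LrfDepthOneStatic

open LrfDepthOneSeq

/-! ### The rearrangement inequality -/

section Rearrangement

variable {ι : Type*} (p u : ι → ℝ)

/-- **Adjacent exchange**: with `F(x :: L) = p_x u_x + (1 − p_x) F(L)`,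
`F(y :: x :: L) − F(x :: y :: L) = p_x p_y (u_y − u_x)`, so moving the element with the larger
`u` to the front does not decrease `F`. [folklore] -/
theorem foldr_cons_cons_le_swap (hp0 : ∀ i, 0 ≤ p i) {x y : ι} (hxy : u x ≤ u y) (L : List ι) :
    (x :: y :: L).foldr (fun z r => p z * u z + (1 - p z) * r) 0 ≤
      (y :: x :: L).foldr (fun z r => p z * u z + (1 - p z) * r) 0 := by
  simp only [List.foldr_cons]
  nlinarith [mul_nonneg (mul_nonneg (hp0 x) (hp0 y)) (sub_nonneg.2 hxy)]

variable (r : ι → ι → Prop) [DecidableRel r]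

/-- **Ordered insertion does not decrease `F`**: if every element `y` that `x` has to pass
(`¬ r x y`) satisfies `u_x ≤ u_y`, then `F(x :: L) ≤ F(L.orderedInsert r x)`. [folklore] -/
theorem foldr_cons_le_orderedInsert (hp0 : ∀ i, 0 ≤ p i) (hp1 : ∀ i, p i ≤ 1)
    (hu : ∀ x y, ¬ r x y → u x ≤ u y) (x : ι) (L : List ι) :
    (x :: L).foldr (fun z r => p z * u z + (1 - p z) * r) 0 ≤
      (L.orderedInsert r x).foldr (fun z r => p z * u z + (1 - p z) * r) 0 := by
  induction L with
  | nil => simp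
  | cons y L ih =>
    rw [List.orderedInsert_cons]
    split_ifs with h
    · exact le_rfl
    · refine (foldr_cons_cons_le_swap p u hp0 (hu x y h) L).trans ?_
      simp only [List.foldr_cons] at ih ⊢
      exact add_le_add le_rfl (mul_le_mul_of_nonneg_left ih (sub_nonneg.2 (hp1 y)))

/-- **Insertion sort does not decrease `F`** (bubble-sort form of the rearrangement
inequality). [folklore] -/
theorem foldr_le_insertionSort (hp0 : ∀ i, 0 ≤ p i) (hp1 : ∀ i, p i ≤ 1)
    (hu : ∀ x y, ¬ r x y → u x ≤ u y) (L : List ι) :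
    L.foldr (fun z r => p z * u z + (1 - p z) * r) 0 ≤
      (L.insertionSort r).foldr (fun z r => p z * u z + (1 - p z) * r) 0 := by
  induction L with
  | nil => simp
  | cons x L ih =>
    rw [List.insertionSort_cons]
    refine le_trans ?_ (foldr_cons_le_orderedInsert p u r hp0 hp1 hu x (L.insertionSort r))
    simp only [List.foldr_cons]
    exact add_le_add le_rfl (mul_le_mul_of_nonneg_left ih (sub_nonneg.2 (hp1 x)))

end Rearrangement

/-- **The fold is the displayed sum**: for a tuple `f : Fin m → ι`,
`F(List.ofFn f) = Σ_i p_{f i} ∏_{l<i} (1 − p_{f l}) u_{f i}`. [folklore] -/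
theorem foldr_ofFn_eq_sum {ι : Type*} (p u : ι → ℝ) : ∀ (m : ℕ) (f : Fin m → ι),
    (List.ofFn f).foldr (fun z r => p z * u z + (1 - p z) * r) 0 =
      ∑ i : Fin m, p (f i) *
        (∏ l ∈ Finset.univ.filter (fun l : Fin m => l < i), (1 - p (f l))) * u (f i) := by
  intro m
  induction m with
  | zero => intro f; simp
  | succ m ih =>
    intro f
    rw [List.ofFn_succ, List.foldr_cons, ih (fun i => f i.succ), Fin.sum_univ_succ,
      prod_filter_lt_zero_one_sub, mul_one, Finset.mul_sum]
    congr 1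
    refine Finset.sum_congr rfl fun i _ => ?_
    rw [prod_filter_lt_succ (fun l => 1 - p (f l)) i]
    ring

/-- **Rearrangement inequality** for `F(σ) = Σ_i p_{σ i} ∏_{l<i} (1 − p_{σ l}) u_{σ i}`:
if `p_i ∈ [0, 1]` and `u` is non-increasing, the identity order maximises `F`. [folklore] -/
theorem sum_perm_le {k : ℕ} (p u : Fin k → ℝ) (hp0 : ∀ i, 0 ≤ p i) (hp1 : ∀ i, p i ≤ 1)
    (hu : ∀ x y : Fin k, y < x → u x ≤ u y) (σ : Equiv.Perm (Fin k)) :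
    ∑ i : Fin k, p (σ i) *
        (∏ l ∈ Finset.univ.filter (fun l : Fin k => l < i), (1 - p (σ l))) * u (σ i) ≤
      ∑ i : Fin k, p i * (∏ l ∈ Finset.univ.filter (fun l : Fin k => l < i), (1 - p l)) * u i := by
  have hsort : (List.ofFn σ).insertionSort (· ≤ ·) = List.ofFn id := by
    refine List.Perm.eq_of_pairwise' (List.pairwise_insertionSort (· ≤ ·) _) ?_ ?_
    · rw [List.ofFn_id]
      exact List.pairwise_le_finRange k
    · refine (List.perm_insertionSort _ _).trans ?_
      rw [List.ofFn_eq_map, List.ofFn_id]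
      exact σ.map_finRange_perm
  have hu' : ∀ x y : Fin k, ¬ x ≤ y → u x ≤ u y := fun x y h => hu x y (not_le.1 h)
  calc ∑ i : Fin k, p (σ i) *
        (∏ l ∈ Finset.univ.filter (fun l : Fin k => l < i), (1 - p (σ l))) * u (σ i)
      = (List.ofFn σ).foldr (fun z r => p z * u z + (1 - p z) * r) 0 :=
        (foldr_ofFn_eq_sum p u k σ).symm
    _ ≤ ((List.ofFn σ).insertionSort (· ≤ ·)).foldr (fun z r => p z * u z + (1 - p z) * r) 0 :=
        foldr_le_insertionSort p u (· ≤ ·) hp0 hp1 hu' _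
    _ = (List.ofFn id).foldr (fun z r => p z * u z + (1 - p z) * r) 0 := by rw [hsort]
    _ = _ := foldr_ofFn_eq_sum p u k id

/-! ### A sequential order exists -/

/-- **Bookkeeping of the zeroed weights**: sequential admissibility of a family
`d : Fin (k+1) → Fin n` for `w` follows from minimality of `d 0 = x₀` in `w` together with
sequential admissibility of the tail `t = d ∘ Fin.succ` for `w[s(o, x₀) ↦ 0]`. [folklore] -/
theorem seqAdm_cons {n k : ℕ} (w : Sym2 (Fin n) → unitInterval) (o b : Fin n)
    (d : Fin (k + 1) → Fin n) (x₀ : Fin n) (t : Fin k → Fin n) (hd0 : d 0 = x₀)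
    (ht : ∀ m, d m.succ = t m)
    (h0 : ∀ i, (prodBernoulli w).real (openConn x₀ b) ≤ (prodBernoulli w).real (openConn (d i) b))
    (h1 : ∀ j i : Fin k, j < i →
      (prodBernoulli (fun e => if ∃ l : Fin k, l < j ∧ e = s(o, t l) then 0
          else Function.update w s(o, x₀) 0 e)).real (openConn (t j) b) ≤
        (prodBernoulli (fun e => if ∃ l : Fin k, l < j ∧ e = s(o, t l) then 0
          else Function.update w s(o, x₀) 0 e)).real (openConn (t i) b)) :
    ∀ j i : Fin (k + 1), j < i →
      (prodBernoulli (fun e => if ∃ l : Fin (k + 1), l < j ∧ e = s(o, d l) then 0 else w e)).real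
          (openConn (d j) b) ≤
        (prodBernoulli (fun e => if ∃ l : Fin (k + 1), l < j ∧ e = s(o, d l) then 0 else w e)).real
          (openConn (d i) b) := by
  intro j i hji
  rcases Fin.eq_zero_or_eq_succ j with rfl | ⟨j', rfl⟩
  · have hw0 : (fun e => if ∃ l : Fin (k + 1), l < 0 ∧ e = s(o, d l) then (0 : unitInterval)
        else w e) = w := by
      funext e
      rw [if_neg]
      rintro ⟨l, hl, -⟩
      exact Fin.not_lt_zero l hl
    rw [hw0, hd0]
    exact h0 i
  · rcases Fin.eq_zero_or_eq_succ i with rfl | ⟨i', rfl⟩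
    · exact absurd hji (Fin.not_lt_zero _)
    have hW : (fun e => if ∃ l : Fin (k + 1), l < j'.succ ∧ e = s(o, d l) then (0 : unitInterval)
        else w e) =
        (fun e => if ∃ l : Fin k, l < j' ∧ e = s(o, t l) then (0 : unitInterval)
          else Function.update w s(o, x₀) 0 e) := by
      funext e
      by_cases he : e = s(o, x₀)
      · have h2 : ∃ l : Fin (k + 1), l < j'.succ ∧ e = s(o, d l) :=
          ⟨0, Fin.succ_pos j', by rw [hd0]; exact he⟩
        rw [if_pos h2]
        split_ifs
        · rfl
        · rw [he, Function.update_self]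
      · have hiff : (∃ l : Fin (k + 1), l < j'.succ ∧ e = s(o, d l)) ↔
            (∃ l : Fin k, l < j' ∧ e = s(o, t l)) := by
          constructor
          · rintro ⟨l, hl, rfl⟩
            rcases Fin.eq_zero_or_eq_succ l with rfl | ⟨l', rfl⟩
            · exact absurd (by rw [hd0]) he
            · exact ⟨l', Fin.succ_lt_succ_iff.1 hl, by rw [ht]⟩
          · rintro ⟨l, hl, rfl⟩
            exact ⟨l.succ, Fin.succ_lt_succ_iff.2 hl, by rw [ht]⟩
        by_cases hc : ∃ l : Fin (k + 1), l < j'.succ ∧ e = s(o, d l)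
        · rw [if_pos hc, if_pos (hiff.1 hc)]
        · rw [if_neg hc, if_neg (fun h => hc (hiff.2 h)), Function.update_of_ne he]
    rw [hW, ht j', ht i']
    exact h1 j' i' (Fin.succ_lt_succ_iff.1 hji)

/-- **Greedy construction of a sequentially admissible order**: for any family of relays
`c : Fin k → Fin n` there is a permutation `σ` such that `c (σ j)` is the least reliable of
`c (σ j), …, c (σ (k-1))` for the weights with the pairs `s(o, c (σ l))`, `l < j`, zeroed. [folklore] -/
theorem exists_seqOrder {n : ℕ} (o b : Fin n) : ∀ (k : ℕ) (w : Sym2 (Fin n) → unitInterval)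
    (c : Fin k → Fin n), ∃ σ : Equiv.Perm (Fin k), ∀ j i : Fin k, j < i →
      (prodBernoulli (fun e => if ∃ l : Fin k, l < j ∧ e = s(o, c (σ l)) then 0 else w e)).real
          (openConn (c (σ j)) b) ≤
        (prodBernoulli (fun e => if ∃ l : Fin k, l < j ∧ e = s(o, c (σ l)) then 0 else w e)).real
          (openConn (c (σ i)) b) := by
  intro k
  induction k with
  | zero =>
    intro w c
    exact ⟨1, fun j => j.elim0⟩
  | succ k ih =>
    intro w c
    obtain ⟨i₀, -, hmin⟩ := Finset.exists_min_image Finset.univ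
      (fun i => (prodBernoulli w).real (openConn (c i) b)) Finset.univ_nonempty
    obtain ⟨σ', hσ'⟩ := ih (Function.update w s(o, c i₀) 0)
      (fun m => c (Equiv.swap 0 i₀ m.succ))
    refine ⟨Equiv.Perm.decomposeFin.symm (i₀, σ'), ?_⟩
    exact seqAdm_cons w o b (fun m => c (Equiv.Perm.decomposeFin.symm (i₀, σ') m)) (c i₀)
      (fun m => c (Equiv.swap 0 i₀ (σ' m).succ))
      (by rw [Equiv.Perm.decomposeFin_symm_apply_zero])
      (fun m => by rw [Equiv.Perm.decomposeFin_symm_apply_succ])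
      (fun i => hmin _ (Finset.mem_univ _)) hσ'

end LrfDepthOneStatic

open LrfDepthOneStatic in
/-- **Least-reliable-first at depth one, static order, all `|A|`** (the depth-one case of the
registered LRF conjecture `stub_lrfGluing`): if every positive-weight neighbour of `o` is among
the relays `a i` (injective, `≠ o`), sorted by unreliability in `w`
(`μ(a j ↔ b) ≤ μ(a i ↔ b)` for `j < i`), then
`μ(o ↮ b, ∃ i, o ↔ a i) ≤ Σ_i p_i ∏_{l<i} (1 − p_l) · μ(a i ↮ b)`, `p_i = w s(o, a i)`.
Proof: a greedy sequentially admissible reordering `a ∘ σ` exists (`exists_seqOrder`), the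
sequential theorem `stub_lrfDepthOneSeq` bounds the (order-independent) bad event by `F(σ)`,
and `F(σ) ≤ F(id)` by the rearrangement inequality `sum_perm_le`. -/
theorem stub_lrfDepthOneStatic :
    ∀ (n k : ℕ) (w : Sym2 (Fin n) → unitInterval) (o b : Fin n) (a : Fin k → Fin n),
      Function.Injective a → (∀ i, a i ≠ o) →
      (∀ x : Fin n, x ≠ o → w s(o, x) ≠ 0 → ∃ i, a i = x) →
      (∀ j i : Fin k, j < i →
        (prodBernoulli w).real (openConn (a j) b) ≤ (prodBernoulli w).real (openConn (a i) b)) →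
      (prodBernoulli w).real {ω | ω ∉ openConn o b ∧ ∃ i, ω ∈ openConn o (a i)} ≤
        ∑ i : Fin k, (w s(o, a i) : ℝ) * (∏ l ∈ Finset.univ.filter (fun l : Fin k => l < i), (1 - (w s(o, a l) : ℝ))) *
          (prodBernoulli w).real (openConn (a i) b)ᶜ := by
  intro n k w o b a hinj hao hdep hmono
  obtain ⟨σ, hσ⟩ := exists_seqOrder o b k w a
  -- the sequential theorem for the reordered family `a ∘ σ`
  have hseq := stub_lrfDepthOneSeq n k w o b (fun m => a (σ m)) (hinj.comp σ.injective)
    (fun i => hao _)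
    (fun x hxo hx => by
      obtain ⟨i, hi⟩ := hdep x hxo hx
      exact ⟨σ.symm i, by simpa using hi⟩)
    hσ
  -- the bad event does not depend on the order of the relays
  have hset : {ω : Set (Sym2 (Fin n)) | ω ∉ openConn o b ∧ ∃ i, ω ∈ openConn o (a i)} =
      {ω | ω ∉ openConn o b ∧ ∃ i, ω ∈ openConn o (a (σ i))} := by
    ext ω
    simp only [Set.mem_setOf_eq]
    refine and_congr_right fun _ => ⟨?_, ?_⟩
    · rintro ⟨i, hi⟩
      exact ⟨σ.symm i, by rwa [Equiv.apply_symm_apply]⟩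
    · rintro ⟨i, hi⟩
      exact ⟨σ i, hi⟩
  -- `u = μ(a · ↮ b)` is non-increasing
  have hu : ∀ x y : Fin k, y < x →
      (prodBernoulli w).real (openConn (a x) b)ᶜ ≤ (prodBernoulli w).real (openConn (a y) b)ᶜ := by
    intro x y hyx
    rw [probReal_compl_eq_one_sub MeasurableSet.of_discrete,
      probReal_compl_eq_one_sub MeasurableSet.of_discrete]
    linarith [hmono y x hyx]
  rw [hset]
  refine hseq.trans ?_
  exact sum_perm_le (fun i => (w s(o, a i) : ℝ)) (fun i => (prodBernoulli w).real (openConn (a i) b)ᶜ)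
    (fun i => (w _).2.1) (fun i => (w _).2.2) hu σ

end Summit.CriticalPhenomena.PercolationContinuityZ3.Theorems
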